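/-
Copyright (c) 2026 the pub-hodgecm-mathlib formalisation cell (harness21).  Prover seat hodgecm-mathlib-B-p04 (g47): LH4-plan (g6) price list (P1a-β₂) — the wild
unit-discriminant twin of ★ (D2-β) `TypeTwoEigenFieldPackage`, assembled; 2026-09-02.
-/
import Literature.NumberTheory.NumberFields.RamifiedQuadraticDictionaryWild       -- ★ p851701 (B-p08 (g40)): (W1) `ramifiedPlace_currency_of_wildUnit`, (L1u) `exists_sqrt_and_coord_of_wildUnit`, (L2u) `exists_involutions_of_wildUnit`
import Literature.NumberTheory.Rogawski1990.TypeTwoEigenFieldPackageWildOfFrame   -- ★ (this seat): `eigenField_package_wildUnit_of_frame` (β₁)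
import HarnessLib

/-!
# T3′ P-2 row (R2²), organ (D2-β)′ «THE EIGEN-FIELD PACKAGE AT w» at a WILD UNIT-DISCRIMINANT row — the `∃ α s̃ ι′` package (Rogawski 1990 Lemma 4.9.3; Serre I §6, V §2)

Topic `NumberTheory/Rogawski1990`; namespace `Literature.NumberTheory.Rogawski1990`.  ONE THEOREM (no definition, no instance, no notation, no named fact, no `sorry`); kernel lane
`--supports stmt-HodgeConjecture-24833`.  Cell `pub/hodgecm-mathlib` (D-0151), crux H413 = `stmt-HodgeConjecture-24833`; LH4-plan (g6) WORD #40 price list (P1a) = B-p04 (g47) memo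
`MEMO-M4-wild-parity.v1` §4 (c) LOCAL half, part β₂: the two `obtain`s of ★ p851701 (L1u)(L2u) fed into ★ `eigenField_package_wildUnit_of_frame` (β₁).  Token-parallel to ★ (D2-β)
`TypeTwoEigenFieldPackage.exists_eigenField_package` (binders `σ δ m hσδ hδ hm`, `d = 1 + w₀`, `hw₀`, `h4`, `hdm`, `hϖ`, `s hss hsd hsϖ hsv hmove hnormF`, eigen-data with `h2e hD hσD hσt hσy
hn hN ht2` and the NEW `hχ1`; NO `h2`), so (D3)∕(D4)-type consumers switch rows by substitution.  HONEST LABEL: HC_CM is proved only modulo the 7 printed citations (2 remaining named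
inputs: hLiu418 = stmt-HodgeConjecture-24832, h413 = stmt-HodgeConjecture-24833) until rung 0 closes; count-neutral (pays no organ, opens no road).

## References
* [Rogawski1990] J. D. Rogawski, *Automorphic Representations of Unitary Groups in Three Variables* (1990): §4.9 Lemma 4.9.3 p. 56, Prop. 4.9.1 (b) p. 55.
* [SerreLocalFields1979] J.-P. Serre, *Local Fields*, GTM 67 (1979): Ch. I §6 Prop. 17–18; Ch. V §2 Prop. 3 and Corollary.
* [Jacobowitz1962] R. Jacobowitz, *Hermitian forms over local fields*, Amer. J. Math. 84 (1962): §§9–11.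
-/

set_option autoImplicit false

noncomputable section

open NumberField IsDedekindDomain Polynomial WithZero
open scoped ValuativeRel
open Literature.NumberTheory.Automorphic Literature.NumberTheory.Automorphic.UnitaryGroup Literature.NumberTheory.NumberFields

namespace Literature.NumberTheory.Rogawski1990

variable {F : Type} (E : Type) [Field F] [NumberField F] [Field E] [NumberField E] [Algebra F E] [Algebra.IsQuadraticExtension F E]
  (v : HeightOneSpectrum (𝓞 F)) (σ : E ≃ₐ[F] E) {δ : E} (hσδ : σ δ = -δ) (hδ : δ ≠ 0) {m : F} (hm : algebraMap F E m = δ ^ 2)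
  {d w₀ : v.adicCompletion F} (hdw : d = 1 + w₀) {k : ℕ} (hw₀ : Valued.v w₀ = exp (-(2 * (k : ℤ) + 1)))
  (h4 : Valued.v (4 : v.adicCompletion F) < Valued.v w₀) (hdm : IsSquare (d⁻¹ * (m : v.adicCompletion F)))
  {ϖ : v.adicCompletion F} (hϖ : Valued.v ϖ = exp (-1 : ℤ)) (w : PlacesOver E v)
  (s : v.adicCompletion F →+* v.adicCompletion F) (hss : ∀ x, s (s x) = x) (hsd : s d = d) (hsϖ : s ϖ = ϖ) (hsv : ∀ x, Valued.v (s x) = Valued.v x)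
  (hmove : ∃ a : 𝒪[v.adicCompletion F], IsUnit a ∧ s a - a ∈ 𝒪[v.adicCompletion F] ∧ ∃ b : 𝒪[v.adicCompletion F], (b : v.adicCompletion F) * (s a - a) = 1)
  (hnormF : ∀ c : v.adicCompletion F, c ≠ 0 → s c = c → Even (log (Valued.v c)) → ∃ a : v.adicCompletion F, a * s a * c = 1)
  (u t D y e₂ : v.adicCompletion F) (h2e : e₂ * 2 = 1) (hD : 4 * D = t * t - y * y * d)
  (hσD : D * s D = 1) (hσt : s t = t * s D) (hσy : s y = -(y * s D))
  {n N : ℕ} (hn : Valued.v (u * u - t * u + D) = exp (-(n : ℤ))) (hN : Valued.v y = exp (-(N : ℤ)))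
  (ht2 : Valued.v (t - 2) < 1) (hχ1 : Valued.v (1 - t + D) < 1)

include hσδ hδ hm hdw hw₀ h4 hdm hϖ hss hsd hsϖ hsv hmove hnormF h2e hD hσD hσt hσy hn hN ht2 hχ1 in
/-- **(D2-β)′ THE EIGEN-FIELD PACKAGE AT `w`, WILD UNIT-DISCRIMINANT ROW** — ★ (D2-β)'s statement with `θ ↦ α` (`|α| = 1`), `(1, θ) ↦ (1, (α − 1)∕ι₁ϖ^k)`,
`|λ₁ − ι′λ₁| = exp(−2N)`, and no `|2| = 1` (★ (L1u) + ★ (L2u) + ★ β₁). [cite: Rogawski1990, §4.9 Lemma 4.9.3 p. 56] [cite: SerreLocalFields1979, Ch. I §6 Prop. 17–18; Ch. V §2 Prop. 3]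
[cite: Jacobowitz1962, §§9–11] -/
theorem exists_eigenField_package_wildUnit :
    ∃ (α : w.1.adicCompletion E) (s' ι' : w.1.adicCompletion E →+* w.1.adicCompletion E),
      (α ^ 2 = toPlace v w d ∧ Valued.v α = 1 ∧ Valued.v ((α - 1) / toPlace v w ϖ ^ k) = exp (-1 : ℤ) ∧
        (∀ z : w.1.adicCompletion E, ∃! pq : v.adicCompletion F × v.adicCompletion F, z = toPlace v w pq.1 + toPlace v w pq.2 * ((α - 1) / toPlace v w ϖ ^ k)) ∧
        (∀ p q : v.adicCompletion F, toPlace v w p + toPlace v w q * ((α - 1) / toPlace v w ϖ ^ k) ∈ 𝒪[w.1.adicCompletion E] ↔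
          p ∈ 𝒪[v.adicCompletion F] ∧ q ∈ 𝒪[v.adicCompletion F])) ∧
      ((∀ x, s' (toPlace v w x) = toPlace v w (s x)) ∧ s' α = α ∧ (∀ z, s' (s' z) = z) ∧
        (∀ z : 𝒪[w.1.adicCompletion E], s' z ∈ 𝒪[w.1.adicCompletion E]) ∧ (∀ z, Valued.v (s' z) = Valued.v z)) ∧
      ((∀ x, ι' (toPlace v w x) = toPlace v w x) ∧ ι' α = -α ∧ (∀ z, ι' (ι' z) = z) ∧
        (∀ z : 𝒪[w.1.adicCompletion E], ι' z ∈ 𝒪[w.1.adicCompletion E]) ∧ (∀ z, Valued.v (ι' z) = Valued.v z) ∧ (∀ z, s' (ι' z) = ι' (s' z))) ∧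
      (((toPlace v w t + toPlace v w y * α) * toPlace v w e₂) ^ 2 - toPlace v w t * ((toPlace v w t + toPlace v w y * α) * toPlace v w e₂) + toPlace v w D = 0 ∧
        (toPlace v w t + toPlace v w y * α) * toPlace v w e₂ ∈ 𝒪[w.1.adicCompletion E] ∧
        Valued.v ((toPlace v w t + toPlace v w y * α) * toPlace v w e₂ - 1) < 1 ∧
        (toPlace v w t + toPlace v w y * α) * toPlace v w e₂ * s' ((toPlace v w t + toPlace v w y * α) * toPlace v w e₂) = 1 ∧
        ι' ((toPlace v w t + toPlace v w y * α) * toPlace v w e₂) = (toPlace v w t - toPlace v w y * α) * toPlace v w e₂ ∧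
        ι' ((toPlace v w t + toPlace v w y * α) * toPlace v w e₂) ≠ (toPlace v w t + toPlace v w y * α) * toPlace v w e₂ ∧
        Valued.v (toPlace v w u - (toPlace v w t + toPlace v w y * α) * toPlace v w e₂) = exp (-(n : ℤ)) ∧
        Valued.v ((toPlace v w t + toPlace v w y * α) * toPlace v w e₂ - ι' ((toPlace v w t + toPlace v w y * α) * toPlace v w e₂)) = exp (-(2 * (N : ℤ)))) ∧
      ((∀ x : w.1.adicCompletion E, x ≠ 0 → ι' x = x → Even (log (Valued.v x))) ∧
        (∀ c : w.1.adicCompletion E, c ≠ 0 → s' c = c → Even (log (Valued.v c)) → ∃ a : w.1.adicCompletion E, a * s' a * c = 1) ∧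
        (∀ c : w.1.adicCompletion E, c ≠ 0 → s' c = c → ι' c = c → (4 : ℤ) ∣ log (Valued.v c) →
          ∃ a : w.1.adicCompletion E, ι' a = a ∧ a * s' a * c = 1)) := by
  have he : v.asIdeal.ramificationIdx' w.1.asIdeal = 2 := (ramifiedPlace_currency_of_wildUnit E v σ hσδ hδ hm hdw hw₀ h4 hdm w).2.2
  have hsO : ∀ x : 𝒪[v.adicCompletion F], s x ∈ 𝒪[v.adicCompletion F] := fun x => by
    rw [mem_integer_iff_valued_le_one, hsv]; exact (mem_integer_iff_valued_le_one _).1 x.2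
  obtain ⟨α, hα, hαv, hPv, hcoord, hint⟩ := exists_sqrt_and_coord_of_wildUnit E v σ hσδ hδ hm hdw hw₀ h4 hdm hϖ w
  obtain ⟨⟨s', hs'ι, hs'α, hs's', hs'O⟩, ⟨ι', hι'ι, hι'α, hι'ι', hι'O⟩⟩ :=
    exists_involutions_of_wildUnit E v σ hσδ hδ hm hdw hw₀ h4 hdm hϖ w s hss hsd hsϖ hsO hα
  exact ⟨α, s', ι', eigenField_package_wildUnit_of_frame E v hdw hw₀ h4 hϖ w he hα hαv hPv hcoord hint s hsϖ hsv hmove hnormF u t D y e₂ h2e hD hσD hσt hσy hn hN ht2 hχ1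
    s' ι' hs'ι hs'α hs's' hs'O hι'ι hι'α hι'ι' hι'O⟩

end Literature.NumberTheory.Rogawski1990

end
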